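import Mathlib
import Literature.NumberTheory.Transcendental.KZLogCalculusProofs
import Literature.NumberTheory.Transcendental.KZDominatedFamilyRelations
import Literature.NumberTheory.Transcendental.KZSemialgebraicComplex
import Literature.NumberTheory.Transcendental.SemialgebraicLineDeriv
import Literature.NumberTheory.Transcendental.KZIntervalPeriodProofs
import Summits.KontsevichZagierPeriods.KontsevichZagierPeriods.Theorems.TerasomaMultiplicationBetaCancellationStubMoebiusMove
import Summits.KontsevichZagierPeriods.KontsevichZagierPeriods.Theorems.InverseLandauTateFamilyKernelCurvesStubArcScissors

/-!
# `TateFamilyKernelCurves` (stmt-KontsevichZagierPeriods-9132), line `Sketch` — stub `stub_arcNormalization`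

Arc normalisation in the Kontsevich–Zagier calculus: every arc `[(α, α′), du/(1+u²)]` of the
`u`-line with real-algebraic endpoints `α < α′` is, modulo the relations of the calculus, a formal
sum of STANDARD arcs `[(0, x_k), du/(1+u²)]` with `x_k ∈ (0,1)` real algebraic, and with the same
total angle `Σ_k arctan x_k = arctan α′ − arctan α`.

Two moves suffice. CUT (rule 1a, `KZ.domainAddRel`, after discarding the null cut point with
`KZ.IntegralRep.of_sub_of_restrict_mem_relations`): `[(α,γ)] ≡ [(α,β)] + [(β,γ)]` (`an_cut`).
ROTATION (rule 2): for `1 + αα′ > 0` the Möbius map `u ↦ (u − α)/(1 + αu)` carries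
`[(α, α′), du/(1+u²)]` to `[(0, (α′−α)/(1+αα′)), du/(1+u²)]` — the landed move
`BetaCancellationLine.stub_moebiusMove` with `c = 1/√(1+α²)`, `s = α/√(1+α²)` (`an_rotate`) — and
`arctan α′ − arctan α = arctan ((α′−α)/(1+αα′))` (`Real.arctan_add`). Then an arc `(0, x)` with
`x < 1` is standard; for `x < 3` cut at `1/2` and rotate the upper piece onto
`(0, (x − 1/2)/(1 + x/2))` (length `< 1`); for general `x > 0` do this once more (the rotated
endpoint is `< 2`). A general arc with `1 + αα′ > 0` rotates onto some `(0, x)`; otherwise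
`α < 0 < α′`: cut at `0` and rotate `(α, 0)` onto `(0, −α)`. Families are joined by `Fin.append`.
Arc representations and semialgebraicity of intervals are taken from the landed sibling stub file
`…StubArcScissors` (`as_exists_arcRep`, `as_isSemialgebraic_Ioo`).
-/

noncomputable section

open MeasureTheory Set
open Literature.NumberTheory.Transcendental
open Literature.ModelTheory.ExponentialFields (IsSemialgebraic isSemialgebraic_univ)

namespace Summit.KontsevichZagierPeriods.InverseLandau

/-! ## The two moves: cutting an arc, rotating an arc -/

/-- **Cut** (rule 1a): `[(α,γ)] − [(α,β)] − [(β,γ)] ∈ relations` for the integrand `du/(1+u²)`,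
`α ≤ β ≤ γ` real algebraic: discard the null cut point `{u = β}`
(`KZ.IntegralRep.of_sub_of_restrict_mem_relations`), then domain additivity.
[cite: KontsevichZagier2001, §1.2] -/
theorem an_cut {α β γ : ℝ} (hα : IsAlgebraic ℚ α) (hβ : IsAlgebraic ℚ β) (hγ : IsAlgebraic ℚ γ)
    (hαβ : α ≤ β) (hβγ : β ≤ γ) {ρ ρ₁ ρ₂ : KZ.IntegralRep 1}
    (hρ : ρ.domain = {x | x 0 ∈ Set.Ioo α γ})
    (hρ₁ : ρ₁.domain = {x | x 0 ∈ Set.Ioo α β}) (hρ₂ : ρ₂.domain = {x | x 0 ∈ Set.Ioo β γ})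
    (hi : EqOn ρ.integrand (fun x => 1 / (1 + (x 0) ^ 2)) ρ.domain)
    (hi₁ : EqOn ρ₁.integrand (fun x => 1 / (1 + (x 0) ^ 2)) ρ₁.domain)
    (hi₂ : EqOn ρ₂.integrand (fun x => 1 / (1 + (x 0) ^ 2)) ρ₂.domain) :
    KZ.of ρ - KZ.of ρ₁ - KZ.of ρ₂ ∈ KZ.relations := by
  set E : Set (Fin 1 → ℝ) := {x | x 0 ∈ Set.Ioo α β} ∪ {x | x 0 ∈ Set.Ioo β γ} with hE_def
  have hE : IsSemialgebraic ℚ E :=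
    (as_isSemialgebraic_Ioo hα hβ).union (as_isSemialgebraic_Ioo hβ hγ)
  have hEr : E ⊆ ρ.domain := by
    rw [hρ]
    rintro x (hx | hx)
    · exact ⟨hx.1, hx.2.trans_le hβγ⟩
    · exact ⟨hαβ.trans_lt hx.1, hx.2⟩
  have hvol : volume (ρ.domain \ E) = 0 := by
    refine measure_mono_null (fun x hx => ?_) (KZ.volume_setOf_last_eq_zero (n := 0) β)
    obtain ⟨hx, hxE⟩ := hx
    rw [hρ] at hx
    show x 0 = β
    by_contra hne
    rcases lt_or_gt_of_ne hne with hlt | hgt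
    · exact hxE (Or.inl ⟨hx.1, hlt⟩)
    · exact hxE (Or.inr ⟨hgt, hx.2⟩)
  have h1 := ρ.of_sub_of_restrict_mem_relations hE hEr hvol
  have h2 : KZ.of (ρ.restrict E hE hEr) - KZ.of ρ₁ - KZ.of ρ₂ ∈ KZ.relations := by
    refine KZ.domainAddRel_subset_relations ⟨1, ρ.restrict E hE hEr, ρ₁, ρ₂, ?_, ?_, ?_, ?_, rfl⟩
    · rw [KZ.IntegralRep.domain_restrict, hρ₁, hρ₂]
    · rw [hρ₁, hρ₂]
      exact measure_mono_null (fun x ⟨h1, h2⟩ => (lt_asymm h1.2 h2.1).elim) measure_empty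
    · intro x hx
      have hx' : x ∈ E := Or.inl (by rw [hρ₁] at hx; exact hx)
      rw [KZ.IntegralRep.integrand_restrict, hi (hEr hx'), hi₁ hx]
    · intro x hx
      have hx' : x ∈ E := Or.inr (by rw [hρ₂] at hx; exact hx)
      rw [KZ.IntegralRep.integrand_restrict, hi (hEr hx'), hi₂ hx]
  convert KZ.relations.add_mem h1 h2 using 1
  abel

/-- **Rotation** (rule 2): for `α < α′` real algebraic with `1 + αα′ > 0`, the Möbius map
`u ↦ (u − α)/(1 + αu)` carries `[(α, α′), du/(1+u²)]` onto `[(0, (α′−α)/(1+αα′)), du/(1+u²)]`;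
this is `BetaCancellationLine.stub_moebiusMove` with `c = 1/√(1+α²)`, `s = α/√(1+α²)`, `κ = 1`.
[cite: KontsevichZagier2001, §1.2] -/
theorem an_rotate {α α' : ℝ} (hα : IsAlgebraic ℚ α) (hlt : α < α') (hpos : 0 < 1 + α * α')
    {ρ ρ' : KZ.IntegralRep 1}
    (hρ : ρ.domain = {x | x 0 ∈ Set.Ioo α α'})
    (hi : EqOn ρ.integrand (fun x => 1 / (1 + (x 0) ^ 2)) ρ.domain)
    (hρ' : ρ'.domain = {x | x 0 ∈ Set.Ioo 0 ((α' - α) / (1 + α * α'))})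
    (hi' : EqOn ρ'.integrand (fun x => 1 / (1 + (x 0) ^ 2)) ρ'.domain) :
    KZ.of ρ - KZ.of ρ' ∈ KZ.relations := by
  set r : ℝ := Real.sqrt (1 + α ^ 2)
  have hr0 : 0 < r := Real.sqrt_pos.2 (by positivity)
  have hr2 : r ^ 2 = 1 + α ^ 2 := Real.sq_sqrt (by positivity)
  have hralg : IsAlgebraic ℚ r :=
    IsAlgebraic.of_pow two_pos (by rw [hr2]; exact isAlgebraic_one.add (hα.pow 2))
  have hc : IsAlgebraic ℚ r⁻¹ := hralg.inv
  have hs : IsAlgebraic ℚ (α * r⁻¹) := hα.mul hralg.inv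
  have hcs : r⁻¹ ^ 2 + (α * r⁻¹) ^ 2 = 1 := by
    rw [mul_pow, inv_pow, hr2]
    field_simp
  have hM : ∀ t : ℝ, (r⁻¹ * t - α * r⁻¹) / (α * r⁻¹ * t + r⁻¹) = (t - α) / (1 + α * t) := by
    intro t
    rw [show α * r⁻¹ * t + r⁻¹ = (1 + α * t) * r⁻¹ by ring,
      show r⁻¹ * t - α * r⁻¹ = (t - α) * r⁻¹ by ring]
    exact mul_div_mul_right _ _ (inv_ne_zero hr0.ne')
  have hden : ∀ t ∈ Set.Icc α α', 0 < α * r⁻¹ * t + r⁻¹ := by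
    intro t ht
    have h1 : 0 < 1 + α * t := by
      rcases le_or_gt 0 α with h | h
      · nlinarith [mul_nonneg h (sub_nonneg.2 ht.1), sq_nonneg α]
      · nlinarith [mul_nonneg (neg_nonneg.2 h.le) (sub_nonneg.2 ht.2)]
    rw [show α * r⁻¹ * t + r⁻¹ = (1 + α * t) * r⁻¹ by ring]
    exact mul_pos h1 (inv_pos.2 hr0)
  have hρ'' : ρ'.domain = {x | x 0 ∈ Set.Ioo ((r⁻¹ * α - α * r⁻¹) / (α * r⁻¹ * α + r⁻¹))
      ((r⁻¹ * α' - α * r⁻¹) / (α * r⁻¹ * α' + r⁻¹))} := by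
    rw [hρ', hM, hM, sub_self, zero_div]
  exact Summit.KontsevichZagierPeriods.KontsevichZagierPeriods.BetaCancellationLine.stub_moebiusMove
    r⁻¹ (α * r⁻¹) 1 hc hs isAlgebraic_one hcs α α' hlt hden ρ ρ' hρ hi hρ'' hi'

/-- The angle of a rotated arc: `arctan α′ − arctan α = arctan ((α′−α)/(1+αα′))` when `1 + αα′ > 0`
(`Real.arctan_add` with `y = −α`). [folklore] -/
theorem an_arctan_sub {α α' : ℝ} (hpos : 0 < 1 + α * α') :
    Real.arctan α' - Real.arctan α = Real.arctan ((α' - α) / (1 + α * α')) := by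
  have h : α' * -α < 1 := by nlinarith
  rw [sub_eq_add_neg, ← Real.arctan_neg, Real.arctan_add h]
  congr 1
  rw [show (1 : ℝ) - α' * -α = 1 + α * α' by ring, sub_eq_add_neg]

/-- `1/2` is algebraic over `ℚ`. [folklore] -/
theorem an_isAlgebraic_half : IsAlgebraic ℚ (1 / 2 : ℝ) := by
  have h : IsAlgebraic ℚ ((2 : ℕ) : ℝ) := isAlgebraic_nat 2
  rw [Nat.cast_ofNat] at h
  exact one_div (2 : ℝ) ▸ h.inv

/-- A Möbius-rotated endpoint `(α′ − α)/(1 + αα′)` is algebraic. [folklore] -/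
theorem an_isAlgebraic_moeb {α α' : ℝ} (hα : IsAlgebraic ℚ α) (hα' : IsAlgebraic ℚ α') :
    IsAlgebraic ℚ ((α' - α) / (1 + α * α')) := by
  rw [div_eq_mul_inv]
  exact (hα'.sub hα).mul (isAlgebraic_one.add (hα.mul hα')).inv

/-! ## Bookkeeping of families of standard arcs -/

/-- Concatenation of two families of standard arcs (`Fin.append`): angles and formal sums add.
[folklore] -/
theorem an_append {F₁ F₂ : KZ.FormalRep} {A₁ A₂ : ℝ}
    (h₁ : ∃ (K : ℕ) (x : Fin K → ℝ) (σ : Fin K → KZ.IntegralRep 1),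
      (∀ k, IsAlgebraic ℚ (x k) ∧ 0 < x k ∧ x k < 1) ∧
      (∀ k, (σ k).domain = {y | y 0 ∈ Set.Ioo 0 (x k)} ∧
        Set.EqOn (σ k).integrand (fun y => 1 / (1 + (y 0) ^ 2)) (σ k).domain) ∧
      ∑ k, Real.arctan (x k) = A₁ ∧ F₁ - ∑ k, KZ.of (σ k) ∈ KZ.relations)
    (h₂ : ∃ (K : ℕ) (x : Fin K → ℝ) (σ : Fin K → KZ.IntegralRep 1),
      (∀ k, IsAlgebraic ℚ (x k) ∧ 0 < x k ∧ x k < 1) ∧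
      (∀ k, (σ k).domain = {y | y 0 ∈ Set.Ioo 0 (x k)} ∧
        Set.EqOn (σ k).integrand (fun y => 1 / (1 + (y 0) ^ 2)) (σ k).domain) ∧
      ∑ k, Real.arctan (x k) = A₂ ∧ F₂ - ∑ k, KZ.of (σ k) ∈ KZ.relations) :
    ∃ (K : ℕ) (x : Fin K → ℝ) (σ : Fin K → KZ.IntegralRep 1),
      (∀ k, IsAlgebraic ℚ (x k) ∧ 0 < x k ∧ x k < 1) ∧
      (∀ k, (σ k).domain = {y | y 0 ∈ Set.Ioo 0 (x k)} ∧
        Set.EqOn (σ k).integrand (fun y => 1 / (1 + (y 0) ^ 2)) (σ k).domain) ∧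
      ∑ k, Real.arctan (x k) = A₁ + A₂ ∧ F₁ + F₂ - ∑ k, KZ.of (σ k) ∈ KZ.relations := by
  obtain ⟨K₁, x₁, σ₁, hx₁, hσ₁, hA₁, hF₁⟩ := h₁
  obtain ⟨K₂, x₂, σ₂, hx₂, hσ₂, hA₂, hF₂⟩ := h₂
  refine ⟨K₁ + K₂, Fin.append x₁ x₂, Fin.append σ₁ σ₂, ?_, ?_, ?_, ?_⟩
  · intro k
    refine Fin.addCases (fun k => ?_) (fun k => ?_) k
    · simpa only [Fin.append_left] using hx₁ k
    · simpa only [Fin.append_right] using hx₂ k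
  · intro k
    refine Fin.addCases (fun k => ?_) (fun k => ?_) k
    · simpa only [Fin.append_left] using hσ₁ k
    · simpa only [Fin.append_right] using hσ₂ k
  · rw [Fin.sum_univ_add]
    simp only [Fin.append_left, Fin.append_right, hA₁, hA₂]
  · rw [Fin.sum_univ_add]
    simp only [Fin.append_left, Fin.append_right]
    convert KZ.relations.add_mem hF₁ hF₂ using 1
    abel

/-- Transport of a normalisation along a relation `F − F′ ∈ relations` and an equality of angles.
[folklore] -/
theorem an_congr {F F' : KZ.FormalRep} {A A' : ℝ} (hFF' : F - F' ∈ KZ.relations) (hAA' : A = A')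
    (h : ∃ (K : ℕ) (x : Fin K → ℝ) (σ : Fin K → KZ.IntegralRep 1),
      (∀ k, IsAlgebraic ℚ (x k) ∧ 0 < x k ∧ x k < 1) ∧
      (∀ k, (σ k).domain = {y | y 0 ∈ Set.Ioo 0 (x k)} ∧
        Set.EqOn (σ k).integrand (fun y => 1 / (1 + (y 0) ^ 2)) (σ k).domain) ∧
      ∑ k, Real.arctan (x k) = A' ∧ F' - ∑ k, KZ.of (σ k) ∈ KZ.relations) :
    ∃ (K : ℕ) (x : Fin K → ℝ) (σ : Fin K → KZ.IntegralRep 1),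
      (∀ k, IsAlgebraic ℚ (x k) ∧ 0 < x k ∧ x k < 1) ∧
      (∀ k, (σ k).domain = {y | y 0 ∈ Set.Ioo 0 (x k)} ∧
        Set.EqOn (σ k).integrand (fun y => 1 / (1 + (y 0) ^ 2)) (σ k).domain) ∧
      ∑ k, Real.arctan (x k) = A ∧ F - ∑ k, KZ.of (σ k) ∈ KZ.relations := by
  obtain ⟨K, x, σ, hx, hσ, hA, hF⟩ := h
  refine ⟨K, x, σ, hx, hσ, hA.trans hAA'.symm, ?_⟩
  convert KZ.relations.add_mem hFF' hF using 1
  abel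

/-! ## Normalisation of arcs -/

/-- Base case: an arc `(0, x)` with `0 < x < 1` real algebraic is already standard (`K = 1`).
[folklore] -/
theorem an_base {x : ℝ} (hx : IsAlgebraic ℚ x) (h0 : 0 < x) (h1 : x < 1) (ρ : KZ.IntegralRep 1)
    (hρ : ρ.domain = {y | y 0 ∈ Set.Ioo 0 x})
    (hi : EqOn ρ.integrand (fun y => 1 / (1 + (y 0) ^ 2)) ρ.domain) :
    ∃ (K : ℕ) (x' : Fin K → ℝ) (σ : Fin K → KZ.IntegralRep 1),
      (∀ k, IsAlgebraic ℚ (x' k) ∧ 0 < x' k ∧ x' k < 1) ∧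
      (∀ k, (σ k).domain = {y | y 0 ∈ Set.Ioo 0 (x' k)} ∧
        Set.EqOn (σ k).integrand (fun y => 1 / (1 + (y 0) ^ 2)) (σ k).domain) ∧
      ∑ k, Real.arctan (x' k) = Real.arctan x - Real.arctan 0 ∧
      KZ.of ρ - ∑ k, KZ.of (σ k) ∈ KZ.relations :=
  ⟨1, fun _ => x, fun _ => ρ, fun _ => ⟨hx, h0, h1⟩, fun _ => ⟨hρ, hi⟩, by simp, by simp⟩

/-- Rotation step: if the arcs `(0, (α′−α)/(1+αα′))` normalise, so do the arcs `(α, α′)`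
(`1 + αα′ > 0`), with the same angle `arctan α′ − arctan α`. [cite: KontsevichZagier2001, §1.2] -/
theorem an_step_rotate {α α' : ℝ} (hα : IsAlgebraic ℚ α) (hα' : IsAlgebraic ℚ α') (hlt : α < α')
    (hpos : 0 < 1 + α * α')
    (hN : ∀ ρ' : KZ.IntegralRep 1, ρ'.domain = {x | x 0 ∈ Set.Ioo 0 ((α' - α) / (1 + α * α'))} →
      EqOn ρ'.integrand (fun x => 1 / (1 + (x 0) ^ 2)) ρ'.domain →
      ∃ (K : ℕ) (x : Fin K → ℝ) (σ : Fin K → KZ.IntegralRep 1),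
        (∀ k, IsAlgebraic ℚ (x k) ∧ 0 < x k ∧ x k < 1) ∧
        (∀ k, (σ k).domain = {y | y 0 ∈ Set.Ioo 0 (x k)} ∧
          Set.EqOn (σ k).integrand (fun y => 1 / (1 + (y 0) ^ 2)) (σ k).domain) ∧
        ∑ k, Real.arctan (x k) = Real.arctan ((α' - α) / (1 + α * α')) - Real.arctan 0 ∧
        KZ.of ρ' - ∑ k, KZ.of (σ k) ∈ KZ.relations)
    (ρ : KZ.IntegralRep 1) (hρ : ρ.domain = {x | x 0 ∈ Set.Ioo α α'})
    (hi : EqOn ρ.integrand (fun x => 1 / (1 + (x 0) ^ 2)) ρ.domain) :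
    ∃ (K : ℕ) (x : Fin K → ℝ) (σ : Fin K → KZ.IntegralRep 1),
      (∀ k, IsAlgebraic ℚ (x k) ∧ 0 < x k ∧ x k < 1) ∧
      (∀ k, (σ k).domain = {y | y 0 ∈ Set.Ioo 0 (x k)} ∧
        Set.EqOn (σ k).integrand (fun y => 1 / (1 + (y 0) ^ 2)) (σ k).domain) ∧
      ∑ k, Real.arctan (x k) = Real.arctan α' - Real.arctan α ∧
      KZ.of ρ - ∑ k, KZ.of (σ k) ∈ KZ.relations := by
  obtain ⟨ρ', hρ', hi'⟩ := as_exists_arcRep isAlgebraic_zero (an_isAlgebraic_moeb hα hα')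
  have hi'' : EqOn ρ'.integrand (fun x => 1 / (1 + (x 0) ^ 2)) ρ'.domain :=
    fun y _ => congrFun hi' y
  refine an_congr (an_rotate hα hlt hpos hρ hi hρ' hi'') ?_ (hN ρ' hρ' hi'')
  rw [Real.arctan_zero, sub_zero, an_arctan_sub hpos]

/-- Cut step: if the arcs `(α, β)` and `(β, γ)` normalise, so do the arcs `(α, γ)`
(`α < β < γ` real algebraic), with angle `arctan γ − arctan α`. [cite: KontsevichZagier2001, §1.2] -/
theorem an_step_cut {α β γ : ℝ} (hα : IsAlgebraic ℚ α) (hβ : IsAlgebraic ℚ β)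
    (hγ : IsAlgebraic ℚ γ) (hαβ : α < β) (hβγ : β < γ)
    (N₁ : ∀ ρ₁ : KZ.IntegralRep 1, ρ₁.domain = {x | x 0 ∈ Set.Ioo α β} →
      EqOn ρ₁.integrand (fun x => 1 / (1 + (x 0) ^ 2)) ρ₁.domain →
      ∃ (K : ℕ) (x : Fin K → ℝ) (σ : Fin K → KZ.IntegralRep 1),
        (∀ k, IsAlgebraic ℚ (x k) ∧ 0 < x k ∧ x k < 1) ∧
        (∀ k, (σ k).domain = {y | y 0 ∈ Set.Ioo 0 (x k)} ∧
          Set.EqOn (σ k).integrand (fun y => 1 / (1 + (y 0) ^ 2)) (σ k).domain) ∧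
        ∑ k, Real.arctan (x k) = Real.arctan β - Real.arctan α ∧
        KZ.of ρ₁ - ∑ k, KZ.of (σ k) ∈ KZ.relations)
    (N₂ : ∀ ρ₂ : KZ.IntegralRep 1, ρ₂.domain = {x | x 0 ∈ Set.Ioo β γ} →
      EqOn ρ₂.integrand (fun x => 1 / (1 + (x 0) ^ 2)) ρ₂.domain →
      ∃ (K : ℕ) (x : Fin K → ℝ) (σ : Fin K → KZ.IntegralRep 1),
        (∀ k, IsAlgebraic ℚ (x k) ∧ 0 < x k ∧ x k < 1) ∧
        (∀ k, (σ k).domain = {y | y 0 ∈ Set.Ioo 0 (x k)} ∧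
          Set.EqOn (σ k).integrand (fun y => 1 / (1 + (y 0) ^ 2)) (σ k).domain) ∧
        ∑ k, Real.arctan (x k) = Real.arctan γ - Real.arctan β ∧
        KZ.of ρ₂ - ∑ k, KZ.of (σ k) ∈ KZ.relations)
    (ρ : KZ.IntegralRep 1) (hρ : ρ.domain = {x | x 0 ∈ Set.Ioo α γ})
    (hi : EqOn ρ.integrand (fun x => 1 / (1 + (x 0) ^ 2)) ρ.domain) :
    ∃ (K : ℕ) (x : Fin K → ℝ) (σ : Fin K → KZ.IntegralRep 1),
      (∀ k, IsAlgebraic ℚ (x k) ∧ 0 < x k ∧ x k < 1) ∧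
      (∀ k, (σ k).domain = {y | y 0 ∈ Set.Ioo 0 (x k)} ∧
        Set.EqOn (σ k).integrand (fun y => 1 / (1 + (y 0) ^ 2)) (σ k).domain) ∧
      ∑ k, Real.arctan (x k) = Real.arctan γ - Real.arctan α ∧
      KZ.of ρ - ∑ k, KZ.of (σ k) ∈ KZ.relations := by
  obtain ⟨ρ₁, hρ₁, hi₁⟩ := as_exists_arcRep hα hβ
  obtain ⟨ρ₂, hρ₂, hi₂⟩ := as_exists_arcRep hβ hγ
  have hi₁' : EqOn ρ₁.integrand (fun x => 1 / (1 + (x 0) ^ 2)) ρ₁.domain :=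
    fun y _ => congrFun hi₁ y
  have hi₂' : EqOn ρ₂.integrand (fun x => 1 / (1 + (x 0) ^ 2)) ρ₂.domain :=
    fun y _ => congrFun hi₂ y
  have hcut : KZ.of ρ - (KZ.of ρ₁ + KZ.of ρ₂) ∈ KZ.relations := by
    rw [← sub_sub]
    exact an_cut hα hβ hγ hαβ.le hβγ.le hρ hρ₁ hρ₂ hi hi₁' hi₂'
  refine an_congr hcut ?_ (an_append (N₁ ρ₁ hρ₁ hi₁') (N₂ ρ₂ hρ₂ hi₂'))
  ring

/-- Arcs `(0, x)` with `0 < x < 3` real algebraic normalise: for `x ≥ 1` cut at `1/2` and rotate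
the upper piece onto `(0, (x − 1/2)/(1 + x/2))`, of length `< 1`. [cite: KontsevichZagier2001, §1.2] -/
theorem an_norm_lt_three {x : ℝ} (hx : IsAlgebraic ℚ x) (h0 : 0 < x) (h3 : x < 3)
    (ρ : KZ.IntegralRep 1) (hρ : ρ.domain = {y | y 0 ∈ Set.Ioo 0 x})
    (hi : EqOn ρ.integrand (fun y => 1 / (1 + (y 0) ^ 2)) ρ.domain) :
    ∃ (K : ℕ) (x' : Fin K → ℝ) (σ : Fin K → KZ.IntegralRep 1),
      (∀ k, IsAlgebraic ℚ (x' k) ∧ 0 < x' k ∧ x' k < 1) ∧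
      (∀ k, (σ k).domain = {y | y 0 ∈ Set.Ioo 0 (x' k)} ∧
        Set.EqOn (σ k).integrand (fun y => 1 / (1 + (y 0) ^ 2)) (σ k).domain) ∧
      ∑ k, Real.arctan (x' k) = Real.arctan x - Real.arctan 0 ∧
      KZ.of ρ - ∑ k, KZ.of (σ k) ∈ KZ.relations := by
  rcases lt_or_ge x 1 with h1 | h1
  · exact an_base hx h0 h1 ρ hρ hi
  · have hh := an_isAlgebraic_half
    refine an_step_cut isAlgebraic_zero hh hx (by norm_num) (by linarith)
      (fun ρ₁ hρ₁ hi₁ => an_base hh (by norm_num) (by norm_num) ρ₁ hρ₁ hi₁)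
      (fun ρ₂ hρ₂ hi₂ => ?_) ρ hρ hi
    refine an_step_rotate hh hx (by linarith) (by positivity) (fun ρ' hρ' hi' => ?_) ρ₂ hρ₂ hi₂
    refine an_base (an_isAlgebraic_moeb hh hx) (div_pos (by linarith) (by positivity)) ?_ ρ' hρ' hi'
    rw [div_lt_one (by positivity)]
    linarith

/-- Arcs `(0, x)` with `0 < x` real algebraic normalise: for `x ≥ 3` cut at `1/2` and rotate the
upper piece onto `(0, (x − 1/2)/(1 + x/2))`, of length `< 2 < 3`. [cite: KontsevichZagier2001, §1.2] -/
theorem an_norm_pos {x : ℝ} (hx : IsAlgebraic ℚ x) (h0 : 0 < x)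
    (ρ : KZ.IntegralRep 1) (hρ : ρ.domain = {y | y 0 ∈ Set.Ioo 0 x})
    (hi : EqOn ρ.integrand (fun y => 1 / (1 + (y 0) ^ 2)) ρ.domain) :
    ∃ (K : ℕ) (x' : Fin K → ℝ) (σ : Fin K → KZ.IntegralRep 1),
      (∀ k, IsAlgebraic ℚ (x' k) ∧ 0 < x' k ∧ x' k < 1) ∧
      (∀ k, (σ k).domain = {y | y 0 ∈ Set.Ioo 0 (x' k)} ∧
        Set.EqOn (σ k).integrand (fun y => 1 / (1 + (y 0) ^ 2)) (σ k).domain) ∧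
      ∑ k, Real.arctan (x' k) = Real.arctan x - Real.arctan 0 ∧
      KZ.of ρ - ∑ k, KZ.of (σ k) ∈ KZ.relations := by
  rcases lt_or_ge x 3 with h3 | h3
  · exact an_norm_lt_three hx h0 h3 ρ hρ hi
  · have hh := an_isAlgebraic_half
    refine an_step_cut isAlgebraic_zero hh hx (by norm_num) (by linarith)
      (fun ρ₁ hρ₁ hi₁ => an_base hh (by norm_num) (by norm_num) ρ₁ hρ₁ hi₁)
      (fun ρ₂ hρ₂ hi₂ => ?_) ρ hρ hi
    refine an_step_rotate hh hx (by linarith) (by positivity) (fun ρ' hρ' hi' => ?_) ρ₂ hρ₂ hi₂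
    refine an_norm_lt_three (an_isAlgebraic_moeb hh hx) (div_pos (by linarith) (by positivity)) ?_
      ρ' hρ' hi'
    rw [div_lt_iff₀ (by positivity)]
    linarith

/-- **S6 (arc normalisation).** Every arc `[(α, α′), du/(1+u²)]` with real-algebraic `α < α′` is, modulo
relations, a sum of STANDARD arcs `[(0, x_k), du/(1+u²)]` with `x_k ∈ (0,1)` real algebraic and the same
total angle `Σ arctan x_k = arctan α′ − arctan α`: if `1 + αα′ > 0` rotate onto `(0, (α′−α)/(1+αα′))`
(rule 2, `BetaCancellationLine.stub_moebiusMove`), else `α < 0 < α′`: cut at `0` (rule 1a) and rotate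
the negative piece onto `(0, −α)`; positive arcs `(0, x)` are cut at `1/2` and rotated until `x < 1`.
[cite: KontsevichZagier2001, §1.2] -/
theorem stub_arcNormalization : ∀ (α α' : ℝ), IsAlgebraic ℚ α → IsAlgebraic ℚ α' → α < α' →
    ∀ ρ : KZ.IntegralRep 1, ρ.domain = {x | x 0 ∈ Set.Ioo α α'} →
    Set.EqOn ρ.integrand (fun x => 1 / (1 + (x 0) ^ 2)) ρ.domain →
    ∃ (K : ℕ) (x : Fin K → ℝ) (σ : Fin K → KZ.IntegralRep 1),
      (∀ k, IsAlgebraic ℚ (x k) ∧ 0 < x k ∧ x k < 1) ∧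
      (∀ k, (σ k).domain = {y | y 0 ∈ Set.Ioo 0 (x k)} ∧
        Set.EqOn (σ k).integrand (fun y => 1 / (1 + (y 0) ^ 2)) (σ k).domain) ∧
      ∑ k, Real.arctan (x k) = Real.arctan α' - Real.arctan α ∧
      KZ.of ρ - ∑ k, KZ.of (σ k) ∈ KZ.relations := by
  intro α α' hα hα' hlt ρ hρ hi
  rcases lt_or_ge 0 (1 + α * α') with hpos | hnp
  · refine an_step_rotate hα hα' hlt hpos (fun ρ' hρ' hi' => ?_) ρ hρ hi
    exact an_norm_pos (an_isAlgebraic_moeb hα hα') (div_pos (sub_pos.2 hlt) hpos) ρ' hρ' hi'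
  · have hα0 : α < 0 := lt_of_not_ge fun h => by
      nlinarith [mul_nonneg h (sub_nonneg.2 hlt.le), sq_nonneg α]
    have hα'0 : 0 < α' := lt_of_not_ge fun h => by
      nlinarith [mul_nonneg (neg_nonneg.2 h) (sub_nonneg.2 hlt.le), sq_nonneg α']
    refine an_step_cut hα isAlgebraic_zero hα' hα0 hα'0 (fun ρ₁ hρ₁ hi₁ => ?_)
      (fun ρ₂ hρ₂ hi₂ => an_norm_pos hα' hα'0 ρ₂ hρ₂ hi₂) ρ hρ hi
    refine an_step_rotate hα isAlgebraic_zero hα0 (by rw [mul_zero, add_zero]; exact one_pos)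
      (fun ρ' hρ' hi' => ?_) ρ₁ hρ₁ hi₁
    refine an_norm_pos (an_isAlgebraic_moeb hα isAlgebraic_zero) ?_ ρ' hρ' hi'
    rw [mul_zero, add_zero, div_one, sub_pos]
    exact hα0

end Summit.KontsevichZagierPeriods.InverseLandau

end
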